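import Summits.CriticalPhenomena.PercolationContinuityZ3.Theorems.PercNearOneGluingNoHeavyLowerTailPortCubePhi4Line
import Summits.CriticalPhenomena.PercolationContinuityZ3.Theorems.PercNearOneGluingNoHeavyLowerTailPortCubeTools
import Summits.CriticalPhenomena.PercolationContinuityZ3.Theorems.PercNearOneGluingNoHeavyLowerTailSuperTerminalPortPairs
import Summits.CriticalPhenomena.PercolationContinuityZ3.Theorems.PercNearOneGluingNoHeavyLowerTailSuperTerminalPortBasics
import Literature.Probability.LatticeModels.ProdBernoulliWeightContinuity
import HarnessLib

/-!
# THEOREM R, Case 1: a fractional pair from the port's sure component into a terminal's sure component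

Support file for crux `stmt-CriticalPhenomena-4575` (`NoHeavyLowerTail`), seat `prim-l12-p1` gen 26 (`--supports stmt-CriticalPhenomena-4575`);
memo `run/shared/lean/prim/prim-l12/FROM-prim-l12-p1-g26-THEOREM-R-KERNEL.md`, paper proof `prim-l12-p1/PROOF-PORT-CUBE-gen26.md`.
No definitions, no sorries, standard axioms.  Setting and notation: `…SuperTerminalPortPairs` (coordinates `Q, A, B, C` of the port `c` w.r.t.
root `s`, block partner `a`, singleton `b`; `V4 : Q⁴ ≤ A²B²C`; sure components `K_x`).

THEOREM R (`…SuperTerminalQuarticOfMaxdir.superTerminalQuartic_of_portMaxdir`) proves `V4` on every finite weighted graph from the port-cube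
convexity hypothesis `(MAXDIR)` by induction on the number of pairs with weight in `(0,1)`.  This file is its CASE 1: if some fractional pair
`e = xv` leads from `x ∈ K_c` to `v ∈ K_s ∪ K_a` (`v4_of_sureS_pair`) or to `v ∈ K_b` (`v4_of_sureB_pair`), then `V4` at `w[e ↦ 0]` implies `V4`
at `w`: along `e` the terminal identities of `…SuperTerminalPortPairs` give `X̂ = Â, B̂ ≤ 0` resp. `Â = 0, B̂ = X̂`, so `KEY₄ ≥ 0` on the whole
segment (`PortCubePhi4Line.key4_nonneg_of_XS`), the line function `Φ₄ − C` is convex on `[0,1)` (`convexOn_Phi4Line_Ico`), `≤ 0` at `0` by the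
induction hypothesis and `→ −C(1) ≤ 0` at `1⁻` (`PortCubeTools.tendsto_phi4Line_left_S/_b`), hence `≤ 0` at `w e` (`nonpos_of_convexOn_Ico`).
-/

namespace Summit.CriticalPhenomena.PercolationContinuityZ3.Theorems.SuperTerminalQuarticCaseOne

open MeasureTheory Set Filter Topology Real
open Literature.Probability.Percolation Literature.Probability.LatticeModels
open Summit.CriticalPhenomena.PercolationContinuityZ3.Theorems
open Summit.CriticalPhenomena.PercolationContinuityZ3.Theorems.SuperTerminalPortPairs
open Summit.CriticalPhenomena.PercolationContinuityZ3.Theorems.SuperTerminalPortBasics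
open scoped Classical

variable {V : Type*} [Fintype V]

/-- From `Φ₄ ≤ C` to `V4`: if `Q⁴/(A²B²) ≤ C` with `A, B > 0` then `Q⁴ ≤ A²B²C`. [this work] -/
theorem v4_of_phi4_le {Q A B C : ℝ} (hA : 0 < A) (hB : 0 < B) (h : Q ^ 4 / (A ^ 2 * B ^ 2) ≤ C) : Q ^ 4 ≤ A ^ 2 * B ^ 2 * C := by
  have hpos : 0 < A ^ 2 * B ^ 2 := by positivity
  rw [div_le_iff₀ hpos] at h
  linarith

set_option maxHeartbeats 400000 in
/-- **CASE 1, S-type.**  `x ∈ K_c`, `v ∈ K_s ∪ K_a`, `e = xv` with `0 < w e < 1`, `Q(w) > 0`: `V4` at `w[e↦0]` implies `V4` at `w`. [this work] -/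
theorem v4_of_sureS_pair (w : Sym2 V → unitInterval) {s a b c x v : V}
    (hx : (openGraph {e : Sym2 V | (w e : ℝ) = 1}).Reachable c x)
    (hv : (openGraph {e : Sym2 V | (w e : ℝ) = 1}).Reachable s v ∨ (openGraph {e : Sym2 V | (w e : ℝ) = 1}).Reachable a v)
    (h1 : (w s(x, v) : ℝ) < 1)
    (hQ : 0 < (prodBernoulli w).real (openConn s a ∩ (openConn s b)ᶜ ∩ ((openConn c s)ᶜ ∩ (openConn c a)ᶜ ∩ (openConn c b)ᶜ) : Set (BondConfig V)))
    (hIH : (prodBernoulli (Function.update w s(x, v) 0)).real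
        (openConn s a ∩ (openConn s b)ᶜ ∩ ((openConn c s)ᶜ ∩ (openConn c a)ᶜ ∩ (openConn c b)ᶜ) : Set (BondConfig V)) ^ 4 ≤
      (prodBernoulli (Function.update w s(x, v) 0)).real (openConn s a ∩ (openConn s b)ᶜ ∩ ((openConn c s)ᶜ ∩ (openConn c a)ᶜ) : Set (BondConfig V)) ^ 2 *
      (prodBernoulli (Function.update w s(x, v) 0)).real (openConn s a ∩ (openConn s b)ᶜ ∩ (openConn c b)ᶜ : Set (BondConfig V)) ^ 2 *
      (prodBernoulli (Function.update w s(x, v) 0)).real ((openConn c s)ᶜ ∩ (openConn c a)ᶜ ∩ (openConn c b)ᶜ : Set (BondConfig V))) :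
    (prodBernoulli w).real (openConn s a ∩ (openConn s b)ᶜ ∩ ((openConn c s)ᶜ ∩ (openConn c a)ᶜ ∩ (openConn c b)ᶜ) : Set (BondConfig V)) ^ 4 ≤
      (prodBernoulli w).real (openConn s a ∩ (openConn s b)ᶜ ∩ ((openConn c s)ᶜ ∩ (openConn c a)ᶜ) : Set (BondConfig V)) ^ 2 *
      (prodBernoulli w).real (openConn s a ∩ (openConn s b)ᶜ ∩ (openConn c b)ᶜ : Set (BondConfig V)) ^ 2 *
      (prodBernoulli w).real ((openConn c s)ᶜ ∩ (openConn c a)ᶜ ∩ (openConn c b)ᶜ : Set (BondConfig V)) := by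
  -- terminal identities (before abbreviating, so that `set` rewrites them too)
  obtain ⟨hQ1, hA1⟩ := realQ_realA_update_one_eq_zero_of_sureS w (s := s) (a := a) (b := b) hx hv
  have hB01 := realB_update_zero_le_one_of_sureS w (s := s) (a := a) (b := b) hx hv h1
  set e : Sym2 V := s(x, v) with he
  set EQ : Set (BondConfig V) := openConn s a ∩ (openConn s b)ᶜ ∩ ((openConn c s)ᶜ ∩ (openConn c a)ᶜ ∩ (openConn c b)ᶜ) with hEQ
  set EA : Set (BondConfig V) := openConn s a ∩ (openConn s b)ᶜ ∩ ((openConn c s)ᶜ ∩ (openConn c a)ᶜ) with hEA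
  set EB : Set (BondConfig V) := openConn s a ∩ (openConn s b)ᶜ ∩ (openConn c b)ᶜ with hEB
  set EC : Set (BondConfig V) := (openConn c s)ᶜ ∩ (openConn c a)ᶜ ∩ (openConn c b)ᶜ with hEC
  set Q0 := (prodBernoulli (Function.update w e 0)).real EQ with hQ0d
  set Q1 := (prodBernoulli (Function.update w e 1)).real EQ with hQ1d
  set A0 := (prodBernoulli (Function.update w e 0)).real EA with hA0d
  set A1 := (prodBernoulli (Function.update w e 1)).real EA with hA1d
  set B0 := (prodBernoulli (Function.update w e 0)).real EB with hB0d
  set B1 := (prodBernoulli (Function.update w e 1)).real EB with hB1d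
  set C0 := (prodBernoulli (Function.update w e 0)).real EC with hC0d
  set C1 := (prodBernoulli (Function.update w e 1)).real EC with hC1d
  set t : ℝ := (w e : ℝ) with ht
  have eQ : (prodBernoulli w).real EQ = Q0 - t * Q0 := by rw [real_eq_update_sub w e EQ, ← ht, ← hQ0d, ← hQ1d, hQ1, sub_zero]
  have eA : (prodBernoulli w).real EA = A0 - t * A0 := by rw [real_eq_update_sub w e EA, ← ht, ← hA0d, ← hA1d, hA1, sub_zero]
  have eB : (prodBernoulli w).real EB = B0 - t * (B0 - B1) := by rw [real_eq_update_sub w e EB, ← ht, ← hB0d, ← hB1d]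
  have eC : (prodBernoulli w).real EC = C0 - t * (C0 - C1) := by rw [real_eq_update_sub w e EC, ← ht, ← hC0d, ← hC1d]
  have ht0 : 0 ≤ t := (w e).2.1
  have ht1 : t < 1 := h1
  have h1t : 0 < 1 - t := sub_pos.2 ht1
  -- positivity of the endpoint coordinates
  have hQ0 : 0 < Q0 := by
    by_contra hle
    have : (prodBernoulli w).real EQ ≤ 0 := by
      rw [eQ, show Q0 - t * Q0 = (1 - t) * Q0 by ring]; exact mul_nonpos_of_nonneg_of_nonpos h1t.le (not_lt.1 hle)
    exact absurd this (not_le.2 hQ)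
  have hmono0 := coords_mono (Function.update w e 0) s a b c
  have hmono1 := coords_mono (Function.update w e 1) s a b c
  have hA0 : 0 < A0 := lt_of_lt_of_le hQ0 hmono0.2.1
  have hB0 : 0 < B0 := lt_of_lt_of_le hQ0 hmono0.2.2.1
  have hB1 : 0 < B1 := lt_of_lt_of_le hB0 hB01
  have hC1 : 0 ≤ C1 := le_trans hmono1.1 hmono1.2.2.2.1
  -- positivity and `KEY₄ ≥ 0` along the whole segment `[0,1)`
  have hpos : ∀ τ ∈ Ico (0 : ℝ) 1, 0 < Q0 - τ * Q0 ∧ 0 < A0 - τ * A0 ∧ 0 < B0 - τ * (B0 - B1) := by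
    intro τ hτ
    have h1τ : 0 < 1 - τ := sub_pos.2 hτ.2
    refine ⟨by nlinarith, by nlinarith, by nlinarith [hτ.1]⟩
  have hkey : ∀ τ ∈ Ico (0 : ℝ) 1, 0 ≤ (4 * (-Q0 / (Q0 - τ * Q0)) - 2 * (-A0 / (A0 - τ * A0)) - 2 * (-(B0 - B1) / (B0 - τ * (B0 - B1)))) ^ 2 +
      (4 * (-Q0 ^ 2 / (Q0 - τ * Q0) ^ 2) - 2 * (-A0 ^ 2 / (A0 - τ * A0) ^ 2) - 2 * (-(B0 - B1) ^ 2 / (B0 - τ * (B0 - B1)) ^ 2)) := by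
    intro τ hτ
    obtain ⟨p1, p2, p3⟩ := hpos τ hτ
    refine PortCubePhi4Line.key4_nonneg_of_XS p1 p2 p3 hQ0.le ?_
    have hid : Q0 * (A0 - τ * A0) * (B0 - τ * (B0 - B1)) - (Q0 - τ * Q0) * (A0 * (B0 - τ * (B0 - B1)) + (B0 - B1) * (A0 - τ * A0)) =
        (1 - τ) ^ 2 * Q0 * A0 * (B1 - B0) := by ring
    have hnn : 0 ≤ (1 - τ) ^ 2 * Q0 * A0 * (B1 - B0) :=
      mul_nonneg (mul_nonneg (mul_nonneg (sq_nonneg _) hQ0.le) hA0.le) (sub_nonneg.2 hB01)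
    linarith
  have hconv := PortCubePhi4Line.convexOn_Phi4Line_Ico (c₀ := C0) (dc := C0 - C1) hpos hkey
  -- the value at `0` (induction hypothesis) and the limit at `1⁻`
  have h0 : exp (4 * log (Q0 - 0 * Q0) - 2 * log (A0 - 0 * A0) - 2 * log (B0 - 0 * (B0 - B1))) - (C0 - 0 * (C0 - C1)) ≤ 0 := by
    rw [PortCubePhi4Line.exp_phi4_eq (by simpa using hQ0) (by simpa using hA0) (by simpa using hB0)]
    simp only [zero_mul, sub_zero]
    have : Q0 ^ 4 / (A0 ^ 2 * B0 ^ 2) ≤ C0 := by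
      rw [div_le_iff₀ (by positivity)]
      calc Q0 ^ 4 ≤ A0 ^ 2 * B0 ^ 2 * C0 := hIH
        _ = C0 * (A0 ^ 2 * B0 ^ 2) := by ring
    linarith
  have hlim := PortCubeTools.tendsto_phi4Line_left_S (c₀ := C0) (dc := C0 - C1) hQ0 hA0 (by linarith : 0 < B0 - (B0 - B1))
  have hG := PortCubePhi4Line.nonpos_of_convexOn_Ico hconv h0 (by linarith : -(C0 - (C0 - C1)) ≤ 0) hlim t ⟨ht0, ht1⟩
  -- back to the coordinates of `w`
  obtain ⟨p1, p2, p3⟩ := hpos t ⟨ht0, ht1⟩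
  rw [PortCubePhi4Line.exp_phi4_eq p1 p2 p3] at hG
  rw [eQ, eA, eB, eC]
  exact v4_of_phi4_le p2 p3 (by linarith)

/-- **CASE 1, b-type.**  `x ∈ K_c`, `v ∈ K_b`, `e = xv` with `0 < w e < 1`, `Q(w) > 0`: `V4` at `w[e↦0]` implies `V4` at `w`. [this work] -/
theorem v4_of_sureB_pair (w : Sym2 V → unitInterval) {s a b c x v : V}
    (hx : (openGraph {e : Sym2 V | (w e : ℝ) = 1}).Reachable c x) (hv : (openGraph {e : Sym2 V | (w e : ℝ) = 1}).Reachable b v)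
    (h1 : (w s(x, v) : ℝ) < 1)
    (hQ : 0 < (prodBernoulli w).real (openConn s a ∩ (openConn s b)ᶜ ∩ ((openConn c s)ᶜ ∩ (openConn c a)ᶜ ∩ (openConn c b)ᶜ) : Set (BondConfig V)))
    (hIH : (prodBernoulli (Function.update w s(x, v) 0)).real
        (openConn s a ∩ (openConn s b)ᶜ ∩ ((openConn c s)ᶜ ∩ (openConn c a)ᶜ ∩ (openConn c b)ᶜ) : Set (BondConfig V)) ^ 4 ≤
      (prodBernoulli (Function.update w s(x, v) 0)).real (openConn s a ∩ (openConn s b)ᶜ ∩ ((openConn c s)ᶜ ∩ (openConn c a)ᶜ) : Set (BondConfig V)) ^ 2 *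
      (prodBernoulli (Function.update w s(x, v) 0)).real (openConn s a ∩ (openConn s b)ᶜ ∩ (openConn c b)ᶜ : Set (BondConfig V)) ^ 2 *
      (prodBernoulli (Function.update w s(x, v) 0)).real ((openConn c s)ᶜ ∩ (openConn c a)ᶜ ∩ (openConn c b)ᶜ : Set (BondConfig V))) :
    (prodBernoulli w).real (openConn s a ∩ (openConn s b)ᶜ ∩ ((openConn c s)ᶜ ∩ (openConn c a)ᶜ ∩ (openConn c b)ᶜ) : Set (BondConfig V)) ^ 4 ≤
      (prodBernoulli w).real (openConn s a ∩ (openConn s b)ᶜ ∩ ((openConn c s)ᶜ ∩ (openConn c a)ᶜ) : Set (BondConfig V)) ^ 2 *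
      (prodBernoulli w).real (openConn s a ∩ (openConn s b)ᶜ ∩ (openConn c b)ᶜ : Set (BondConfig V)) ^ 2 *
      (prodBernoulli w).real ((openConn c s)ᶜ ∩ (openConn c a)ᶜ ∩ (openConn c b)ᶜ : Set (BondConfig V)) := by
  -- terminal identities (before abbreviating, so that `set` rewrites them too)
  obtain ⟨hQ1, hB1⟩ := realQ_realB_update_one_eq_zero_of_sureB w (s := s) (a := a) (b := b) hx hv
  have hA10 := realA_update_one_eq_zero_eq_of_sureB w (s := s) (a := a) (b := b) hx hv h1
  set e : Sym2 V := s(x, v) with he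
  set EQ : Set (BondConfig V) := openConn s a ∩ (openConn s b)ᶜ ∩ ((openConn c s)ᶜ ∩ (openConn c a)ᶜ ∩ (openConn c b)ᶜ) with hEQ
  set EA : Set (BondConfig V) := openConn s a ∩ (openConn s b)ᶜ ∩ ((openConn c s)ᶜ ∩ (openConn c a)ᶜ) with hEA
  set EB : Set (BondConfig V) := openConn s a ∩ (openConn s b)ᶜ ∩ (openConn c b)ᶜ with hEB
  set EC : Set (BondConfig V) := (openConn c s)ᶜ ∩ (openConn c a)ᶜ ∩ (openConn c b)ᶜ with hEC
  set Q0 := (prodBernoulli (Function.update w e 0)).real EQ with hQ0d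
  set Q1 := (prodBernoulli (Function.update w e 1)).real EQ with hQ1d
  set A0 := (prodBernoulli (Function.update w e 0)).real EA with hA0d
  set A1 := (prodBernoulli (Function.update w e 1)).real EA with hA1d
  set B0 := (prodBernoulli (Function.update w e 0)).real EB with hB0d
  set B1 := (prodBernoulli (Function.update w e 1)).real EB with hB1d
  set C0 := (prodBernoulli (Function.update w e 0)).real EC with hC0d
  set C1 := (prodBernoulli (Function.update w e 1)).real EC with hC1d
  set t : ℝ := (w e : ℝ) with ht
  have eQ : (prodBernoulli w).real EQ = Q0 - t * Q0 := by rw [real_eq_update_sub w e EQ, ← ht, ← hQ0d, ← hQ1d, hQ1, sub_zero]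
  have eA : (prodBernoulli w).real EA = A0 - t * 0 := by rw [real_eq_update_sub w e EA, ← ht, ← hA0d, ← hA1d, hA10, sub_self]
  have eB : (prodBernoulli w).real EB = B0 - t * B0 := by rw [real_eq_update_sub w e EB, ← ht, ← hB0d, ← hB1d, hB1, sub_zero]
  have eC : (prodBernoulli w).real EC = C0 - t * (C0 - C1) := by rw [real_eq_update_sub w e EC, ← ht, ← hC0d, ← hC1d]
  have ht0 : 0 ≤ t := (w e).2.1
  have ht1 : t < 1 := h1
  have h1t : 0 < 1 - t := sub_pos.2 ht1
  have hQ0 : 0 < Q0 := by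
    by_contra hle
    have : (prodBernoulli w).real EQ ≤ 0 := by
      rw [eQ, show Q0 - t * Q0 = (1 - t) * Q0 by ring]; exact mul_nonpos_of_nonneg_of_nonpos h1t.le (not_lt.1 hle)
    exact absurd this (not_le.2 hQ)
  have hmono0 := coords_mono (Function.update w e 0) s a b c
  have hmono1 := coords_mono (Function.update w e 1) s a b c
  have hA0 : 0 < A0 := lt_of_lt_of_le hQ0 hmono0.2.1
  have hB0 : 0 < B0 := lt_of_lt_of_le hQ0 hmono0.2.2.1
  have hC1 : 0 ≤ C1 := le_trans hmono1.1 hmono1.2.2.2.1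
  have hpos : ∀ τ ∈ Ico (0 : ℝ) 1, 0 < Q0 - τ * Q0 ∧ 0 < A0 - τ * 0 ∧ 0 < B0 - τ * B0 := by
    intro τ hτ
    have h1τ : 0 < 1 - τ := sub_pos.2 hτ.2
    refine ⟨by nlinarith, by nlinarith, by nlinarith⟩
  have hkey : ∀ τ ∈ Ico (0 : ℝ) 1, 0 ≤ (4 * (-Q0 / (Q0 - τ * Q0)) - 2 * (-0 / (A0 - τ * 0)) - 2 * (-B0 / (B0 - τ * B0))) ^ 2 +
      (4 * (-Q0 ^ 2 / (Q0 - τ * Q0) ^ 2) - 2 * (-0 ^ 2 / (A0 - τ * 0) ^ 2) - 2 * (-B0 ^ 2 / (B0 - τ * B0) ^ 2)) := by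
    intro τ hτ
    obtain ⟨p1, p2, p3⟩ := hpos τ hτ
    exact PortCubePhi4Line.key4_nonneg_of_XS p1 p2 p3 hQ0.le (le_of_eq (by ring))
  have hconv := PortCubePhi4Line.convexOn_Phi4Line_Ico (c₀ := C0) (dc := C0 - C1) hpos hkey
  have h0 : exp (4 * log (Q0 - 0 * Q0) - 2 * log (A0 - 0 * 0) - 2 * log (B0 - 0 * B0)) - (C0 - 0 * (C0 - C1)) ≤ 0 := by
    rw [PortCubePhi4Line.exp_phi4_eq (by simpa using hQ0) (by simpa using hA0) (by simpa using hB0)]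
    simp only [zero_mul, sub_zero, mul_zero]
    have : Q0 ^ 4 / (A0 ^ 2 * B0 ^ 2) ≤ C0 := by
      rw [div_le_iff₀ (by positivity)]
      calc Q0 ^ 4 ≤ A0 ^ 2 * B0 ^ 2 * C0 := hIH
        _ = C0 * (A0 ^ 2 * B0 ^ 2) := by ring
    linarith
  have hlim := PortCubeTools.tendsto_phi4Line_left_b (c₀ := C0) (dc := C0 - C1) hQ0 hA0 hB0
  have hG := PortCubePhi4Line.nonpos_of_convexOn_Ico hconv h0 (by linarith : -(C0 - (C0 - C1)) ≤ 0) hlim t ⟨ht0, ht1⟩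
  obtain ⟨p1, p2, p3⟩ := hpos t ⟨ht0, ht1⟩
  rw [PortCubePhi4Line.exp_phi4_eq p1 p2 p3] at hG
  rw [eQ, eA, eB, eC]
  exact v4_of_phi4_le p2 p3 (by linarith)

end Summit.CriticalPhenomena.PercolationContinuityZ3.Theorems.SuperTerminalQuarticCaseOne
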